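import Summits.ResolutionOfSingularities.ResolutionOfSingularities.Theorems.FrobeniusLadderFInjectiveMacaulayficationTauFloorP2d5CXChart
import Summits.ResolutionOfSingularities.ResolutionOfSingularities.Theorems.FrobeniusLadderFInjectiveMacaulayficationTauFloorP2d5CYChartNotFull
import Summits.ResolutionOfSingularities.ResolutionOfSingularities.Theorems.FrobeniusLadderFInjectiveMacaulayficationTauFloorP2d5CChartSymmetry
import Summits.ResolutionOfSingularities.ResolutionOfSingularities.Theorems.FrobeniusLadderFInjectiveMacaulayficationTauFloorP2d5CZChart
import Summits.ResolutionOfSingularities.ResolutionOfSingularities.Theorems.FrobeniusLadderFInjectiveMacaulayficationLocalBlowupInputFromCharts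
import Summits.ResolutionOfSingularities.ResolutionOfSingularities.Theorems.FrobeniusLadderFInjectiveMacaulayficationTauFloorInputLegal
import Summits.ResolutionOfSingularities.ResolutionOfSingularities.Theorems.FrobeniusLadderFInjectiveMacaulayficationTauFloorP2d5CRow
import HarnessLib

/-!
# THE FIRST d = 5 KERNEL ROW, INPUT SIDE: the τ-floor of P2d5C is a LEGAL input of the F-half and NOT F(5)-iso — and ROW #1 OF THE F(5)-pos LEDGER AS ONE THEOREM
# (crux `FInjectiveMacaulayfication` stmt-ResolutionOfSingularities-15315, chain w45a; res-L1-w45a-plan-1 g19 RULING R19.15 «(O-1′) THE FIRST d = 5 KERNEL ROW, INPUT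
# SIDE → stub-1», as specified by res-L1-w45a-stub-3 g10; seat res-L1-w45a-stub-1 g11; shapes = res-L1-w45a-stub-3's p635437 `TauFloorP2d4F5RowTwo` §1–§4 one
# dimension up, over res-L1-w45a-stub-1's p627935 `LocalBlowupInputFromCharts` / p624171 `TauFloorInputLegal` / p624800 `TauFloorInputNotFull`)

[OURS · L1 W4.5a] Support file (`--supports stmt-ResolutionOfSingularities-15315 --as helper`); replaces the role of NO printed item; NOT a statement of
any manuscript; def-free; UNCONDITIONAL. AI-written (AI review is weaker than expert review).

WHAT. `X = Spec A₀`, `A₀ = k[X0..X5]/(f)`, `f = X5² + X0⁴X5 + X1³ + X2³ + X3³ + X4³` (P2d5C; `x,y,u,t,s,z = X0..X5`), `char k = 2`, `v` the vertex,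
`τ = Ideal.span {x̄², ȳ, ū, t̄, s̄, z̄}`, `I := τ̃|_{Spec 𝒪_{X,v}} = (affineBlowup.idealSheaf τ).comap (X.fromSpecStalk v)`. For EVERY blowing up `g : S′ → Spec 𝒪_{X,v}` along `I`:
* §1–§2 `cmCl_stalk_affineBlowup_tau_over` — `Bl_τ X` satisfies the CM clause at every point OVER `v`: every such stalk is a local ring of one of the Rees charts
  `D(x̄²), D(ȳ), D(ū), D(t̄), D(s̄)` at a prime over `v` (`D(z̄)` has none: `TauFloorP2d5CZChart.map_vertex_eq_top`), and those charts are CM at EVERY prime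
  (`TauFloorP2d5CXChart.cmCl_localization_blowupAlgebra` p639180, `TauFloorP2d5CYChartIdent.cmCl_localization_blowupAlgebra` p639946, `TauFloorP2d5CChartSymmetry`),
  all by the generic flat–integral engine `FlatIntegralCM` (each chart ring is a free finite tower over a polynomial ring in five variables).
* §3 ★★ `tauFloor_P2d5C_input_legal` [`CharP k 2`] — the four `S′`-side binders of `LocalFInjectivizationFibreAdmGe4`: `I ≠ ⊥`; `Supp I ⊆ (Reg)ᶜ`; `S′` regular off
  the closed fibre; `S′` CM at every point (`LocalBlowupInputFromCharts.offFibre_regular_and_cmCl_over`, p627935).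
* §4 ★★ `tauFloor_P2d5C_not_full` (any field) — some stalk of `S′` over the closed point is NOT FULL (the generic point of the exceptional divisor on `D(ȳ)`,
  `TauFloorP2d5CYChartNotFull.exists_prime_not_fullCl_blowupAlgebra`, via `TauFloorInputNotFull.exists_point_over_centre_not_fullCl` /
  `exists_not_fullCl_of_isBlowup_comap_fromSpecStalk`).
* §5 ★★★ `tauFloor_P2d5C_input` — (legal) ∧ (NOT F(5)-iso) as ONE theorem (this seat's half of the row);
* §6 ★★★ `f5pos_row_one` — ROW #1 OF THE F(5)-pos LEDGER AS ONE KERNEL THEOREM: (legal) ∧ (NOT F(5)-iso) ∧ (cured: res-L1-w45a-stub-2 g9's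
  `TauFloorP2d5CRow.tauFloor_P2d5C_row` over his own `τ·K` product certificate 3b1474399fbc90bb, ✓ p639912/p640289), literally the shape of `f4pos_row_two`.
[folklore assembly; cite: GortzWedhorn2020, (13.19), Prop. 13.91 (2)] [cite: StacksProject, Tag 0804; Tag 02OS; Tag 01J7] [cite: Temkin2008, §2.1]
-/

-- single-problem summit: the doubled namespace component is forced
set_option linter.dupNamespace false

noncomputable section

namespace Summit.ResolutionOfSingularities.ResolutionOfSingularities.Theorems.FInjectiveMacaulayfication.TauFloorP2d5CInput

open CategoryTheory CategoryTheory.Limits AlgebraicGeometry TopologicalSpace IsLocalRing MvPolynomial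
open Literature.AlgebraicGeometry.Resolution
open Summit.ResolutionOfSingularities.ResolutionOfSingularities.Theorems.FInjectiveMacaulayfication
open SliceableCentre GermOfGlobalBlowup

/-! ## §1 The Rees charts of `Bl_τ X` are CM at every prime over the vertex -/

/-- The generator vector presents `τ`. [plumbing] -/
theorem span_range_eq_tau (k : Type) [Field k] (f : MvPolynomial (Fin 6) k) :
    Ideal.span (Set.range ![Ideal.Quotient.mk (Ideal.span {f}) (X 0) ^ 2, Ideal.Quotient.mk (Ideal.span {f}) (X 1), Ideal.Quotient.mk (Ideal.span {f}) (X 2), Ideal.Quotient.mk (Ideal.span {f}) (X 3), Ideal.Quotient.mk (Ideal.span {f}) (X 4), Ideal.Quotient.mk (Ideal.span {f}) (X 5)]) = (Ideal.span {Ideal.Quotient.mk (Ideal.span {f}) (X 0) ^ 2, Ideal.Quotient.mk (Ideal.span {f}) (X 1), Ideal.Quotient.mk (Ideal.span {f}) (X 2), Ideal.Quotient.mk (Ideal.span {f}) (X 3), Ideal.Quotient.mk (Ideal.span {f}) (X 4), Ideal.Quotient.mk (Ideal.span {f}) (X 5)} : Ideal (MvPolynomial (Fin 6) k ⧸ Ideal.span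 {f})) := by
  simp only [Matrix.range_cons, Matrix.range_empty, Set.union_empty, Set.singleton_union]

set_option maxHeartbeats 800000 in
-- six chart cases, each one transport
/-- The six Rees charts of `Bl_τ X` at `a ∈ {x̄², ȳ, ū, t̄, s̄, z̄}` are CM at every prime CONTRACTING TO `v` (for the first five: at every prime; `D(z̄)` has no such
prime). [folklore assembly] -/
theorem cmCl_reesChart_tau_over (k : Type) [Field k] (f : MvPolynomial (Fin 6) k) (hf : f = X 5 ^ 2 + X 0 ^ 4 * X 5 + X 1 ^ 3 + X 2 ^ 3 + X 3 ^ 3 + X 4 ^ 3) (v : Spec (.of (MvPolynomial (Fin 6) k ⧸ Ideal.span {f})))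
    (hv : v.asIdeal = Ideal.span (Set.range fun j : Fin 6 => Ideal.Quotient.mk (Ideal.span {f}) (X j)))
    (a : MvPolynomial (Fin 6) k ⧸ Ideal.span {f}) (ha : a ∈ (Ideal.span {Ideal.Quotient.mk (Ideal.span {f}) (X 0) ^ 2, Ideal.Quotient.mk (Ideal.span {f}) (X 1), Ideal.Quotient.mk (Ideal.span {f}) (X 2), Ideal.Quotient.mk (Ideal.span {f}) (X 3), Ideal.Quotient.mk (Ideal.span {f}) (X 4), Ideal.Quotient.mk (Ideal.span {f}) (X 5)} : Ideal (MvPolynomial (Fin 6) k ⧸ Ideal.span {f})))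
    (h : a = Ideal.Quotient.mk (Ideal.span {f}) (X 0) ^ 2 ∨ a = Ideal.Quotient.mk (Ideal.span {f}) (X 1) ∨ a = Ideal.Quotient.mk (Ideal.span {f}) (X 2) ∨ a = Ideal.Quotient.mk (Ideal.span {f}) (X 3) ∨ a = Ideal.Quotient.mk (Ideal.span {f}) (X 4) ∨ a = Ideal.Quotient.mk (Ideal.span {f}) (X 5))
    (q : PrimeSpectrum (HomogeneousLocalization.Away (reesGrading (Ideal.span {Ideal.Quotient.mk (Ideal.span {f}) (X 0) ^ 2, Ideal.Quotient.mk (Ideal.span {f}) (X 1), Ideal.Quotient.mk (Ideal.span {f}) (X 2), Ideal.Quotient.mk (Ideal.span {f}) (X 3), Ideal.Quotient.mk (Ideal.span {f}) (X 4), Ideal.Quotient.mk (Ideal.span {f}) (X 5)} : Ideal (MvPolynomial (Fin 6) k ⧸ Ideal.span {f}))) (reesT a ha)))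
    (hq : PrimeSpectrum.comap (reesChartBase a ha) q = v) : CMCl (Localization.AtPrime q.asIdeal) := by
  rcases h with rfl | rfl | rfl | rfl | rfl | rfl
  · exact ReesChartFacts.reesChart_cmCl_of_blowupAlgebra_cmCl _ _ ha (fun Q _ => TauFloorP2d5CXChart.cmCl_localization_blowupAlgebra k f hf Q) q.asIdeal
  · exact ReesChartFacts.reesChart_cmCl_of_blowupAlgebra_cmCl _ _ ha (fun Q _ => TauFloorP2d5CYChartIdent.cmCl_localization_blowupAlgebra k f hf Q) q.asIdeal
  · exact ReesChartFacts.reesChart_cmCl_of_blowupAlgebra_cmCl _ _ ha (fun Q _ => TauFloorP2d5CChartSymmetry.cmCl_localization_blowupAlgebra_of_swap k f hf 2 (Or.inl rfl) Q) q.asIdeal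
  · exact ReesChartFacts.reesChart_cmCl_of_blowupAlgebra_cmCl _ _ ha (fun Q _ => TauFloorP2d5CChartSymmetry.cmCl_localization_blowupAlgebra_of_swap k f hf 3 (Or.inr (Or.inl rfl)) Q) q.asIdeal
  · exact ReesChartFacts.reesChart_cmCl_of_blowupAlgebra_cmCl _ _ ha (fun Q _ => TauFloorP2d5CChartSymmetry.cmCl_localization_blowupAlgebra_of_swap k f hf 4 (Or.inr (Or.inr rfl)) Q) q.asIdeal
  · exact absurd hq (LocalBlowupInputFromCharts.not_comap_eq_of_map_eq_top _ _ ha v (TauFloorP2d5CZChart.map_vertex_eq_top k f hf v hv) q)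

/-! ## §2 `Bl_τ X` is CM at every point over `v` -/

set_option maxHeartbeats 800000 in
-- the `Set.range`-presentation transport of `TauFloorInputLegal.cmCl_stalk_affineBlowup_tau`
/-- ★ **`Bl_τ X = affineBlowup τ` satisfies the CM clause at every point over the vertex.** [folklore assembly; cite: StacksProject, Tag 0804] -/
theorem cmCl_stalk_affineBlowup_tau_over (k : Type) [Field k] (f : MvPolynomial (Fin 6) k) (hf : f = X 5 ^ 2 + X 0 ^ 4 * X 5 + X 1 ^ 3 + X 2 ^ 3 + X 3 ^ 3 + X 4 ^ 3) (v : Spec (.of (MvPolynomial (Fin 6) k ⧸ Ideal.span {f})))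
    (hv : v.asIdeal = Ideal.span (Set.range fun j : Fin 6 => Ideal.Quotient.mk (Ideal.span {f}) (X j)))
    (y : ↥(affineBlowup (Ideal.span {Ideal.Quotient.mk (Ideal.span {f}) (X 0) ^ 2, Ideal.Quotient.mk (Ideal.span {f}) (X 1), Ideal.Quotient.mk (Ideal.span {f}) (X 2), Ideal.Quotient.mk (Ideal.span {f}) (X 3), Ideal.Quotient.mk (Ideal.span {f}) (X 4), Ideal.Quotient.mk (Ideal.span {f}) (X 5)} : Ideal (MvPolynomial (Fin 6) k ⧸ Ideal.span {f})))) (hy : (affineBlowup.π (Ideal.span {Ideal.Quotient.mk (Ideal.span {f}) (X 0) ^ 2, Ideal.Quotient.mk (Ideal.span {f}) (X 1), Ideal.Quotient.mk (Ideal.span {f}) (X 2), Ideal.Quotient.mk (Ideal.span {f}) (X 3), Ideal.Quotient.mk (Ideal.span {f}) (X 4), Ideal.Quotient.mk (Ideal.span {f}) (X 5)} : Ideal (MvPolynomial (Fin 6) k ⧸ Ideal.span {f}))).base y = v) :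
    CMCl ((affineBlowup (Ideal.span {Ideal.Quotient.mk (Ideal.span {f}) (X 0) ^ 2, Ideal.Quotient.mk (Ideal.span {f}) (X 1), Ideal.Quotient.mk (Ideal.span {f}) (X 2), Ideal.Quotient.mk (Ideal.span {f}) (X 3), Ideal.Quotient.mk (Ideal.span {f}) (X 4), Ideal.Quotient.mk (Ideal.span {f}) (X 5)} : Ideal (MvPolynomial (Fin 6) k ⧸ Ideal.span {f}))).presheaf.stalk y) := by
  have key : ∀ (J : Ideal (MvPolynomial (Fin 6) k ⧸ Ideal.span {f})), J = (Ideal.span {Ideal.Quotient.mk (Ideal.span {f}) (X 0) ^ 2, Ideal.Quotient.mk (Ideal.span {f}) (X 1), Ideal.Quotient.mk (Ideal.span {f}) (X 2), Ideal.Quotient.mk (Ideal.span {f}) (X 3), Ideal.Quotient.mk (Ideal.span {f}) (X 4), Ideal.Quotient.mk (Ideal.span {f}) (X 5)} : Ideal (MvPolynomial (Fin 6) k ⧸ Ideal.span {f})) →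
      ∀ (i : Fin 6) (hi : (![Ideal.Quotient.mk (Ideal.span {f}) (X 0) ^ 2, Ideal.Quotient.mk (Ideal.span {f}) (X 1), Ideal.Quotient.mk (Ideal.span {f}) (X 2), Ideal.Quotient.mk (Ideal.span {f}) (X 3), Ideal.Quotient.mk (Ideal.span {f}) (X 4), Ideal.Quotient.mk (Ideal.span {f}) (X 5)] : Fin 6 → MvPolynomial (Fin 6) k ⧸ Ideal.span {f}) i ∈ J)
        (q : PrimeSpectrum (HomogeneousLocalization.Away (reesGrading J) (reesT _ hi))), PrimeSpectrum.comap (reesChartBase _ hi) q = v →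
        CMCl (Localization.AtPrime q.asIdeal) := by
    rintro J rfl i hi q hq
    refine cmCl_reesChart_tau_over k f hf v hv _ hi ?_ q hq
    fin_cases i
    exacts [Or.inl rfl, Or.inr (Or.inl rfl), Or.inr (Or.inr (Or.inl rfl)), Or.inr (Or.inr (Or.inr (Or.inl rfl))), Or.inr (Or.inr (Or.inr (Or.inr (Or.inl rfl)))),
      Or.inr (Or.inr (Or.inr (Or.inr (Or.inr rfl))))]
  have h := LocalBlowupInputFromCharts.cmCl_stalk_affineBlowup_of_charts_over (![Ideal.Quotient.mk (Ideal.span {f}) (X 0) ^ 2, Ideal.Quotient.mk (Ideal.span {f}) (X 1), Ideal.Quotient.mk (Ideal.span {f}) (X 2), Ideal.Quotient.mk (Ideal.span {f}) (X 3), Ideal.Quotient.mk (Ideal.span {f}) (X 4), Ideal.Quotient.mk (Ideal.span {f}) (X 5)] : Fin 6 → MvPolynomial (Fin 6) k ⧸ Ideal.span {f}) v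
    (fun i _ q hq => key _ (span_range_eq_tau k f) i _ q hq)
  rw [span_range_eq_tau k f] at h
  exact h y hy

/-! ## §3 The τ-floor is a legal input of the F-half -/

/-- The support `V(τ)` of `τ̃` meets the generizations of `v` only in `v`. [plumbing] -/
theorem support_tau_specializes (k : Type) [Field k] (f : MvPolynomial (Fin 6) k) (v : Spec (.of (MvPolynomial (Fin 6) k ⧸ Ideal.span {f})))
    (hv : v.asIdeal = Ideal.span (Set.range fun j : Fin 6 => Ideal.Quotient.mk (Ideal.span {f}) (X j))) :
    ∀ y ∈ ((affineBlowup.idealSheaf (Ideal.span {Ideal.Quotient.mk (Ideal.span {f}) (X 0) ^ 2, Ideal.Quotient.mk (Ideal.span {f}) (X 1), Ideal.Quotient.mk (Ideal.span {f}) (X 2), Ideal.Quotient.mk (Ideal.span {f}) (X 3), Ideal.Quotient.mk (Ideal.span {f}) (X 4), Ideal.Quotient.mk (Ideal.span {f}) (X 5)} : Ideal (MvPolynomial (Fin 6) k ⧸ Ideal.span {f}))).support : Set (Spec (.of (MvPolynomial (Fin 6) k ⧸ Ideal.span {f})))), y ⤳ v → y = v := by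
  intro y hy hyv
  rw [affineBlowup.support_idealSheaf] at hy
  have hτy : (Ideal.span {Ideal.Quotient.mk (Ideal.span {f}) (X 0) ^ 2, Ideal.Quotient.mk (Ideal.span {f}) (X 1), Ideal.Quotient.mk (Ideal.span {f}) (X 2), Ideal.Quotient.mk (Ideal.span {f}) (X 3), Ideal.Quotient.mk (Ideal.span {f}) (X 4), Ideal.Quotient.mk (Ideal.span {f}) (X 5)} : Ideal (MvPolynomial (Fin 6) k ⧸ Ideal.span {f})) ≤ y.asIdeal := fun a ha => hy ha
  have h1 : v.asIdeal ≤ y.asIdeal := by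
    rw [hv, Ideal.span_le]
    rintro _ ⟨j, rfl⟩
    fin_cases j
    · exact y.2.mem_of_pow_mem 2 (hτy (Ideal.subset_span (by simp)))
    · exact hτy (Ideal.subset_span (by simp))
    · exact hτy (Ideal.subset_span (by simp))
    · exact hτy (Ideal.subset_span (by simp))
    · exact hτy (Ideal.subset_span (by simp))
    · exact hτy (Ideal.subset_span (by simp))
  have h2 : y.asIdeal ≤ v.asIdeal := (PrimeSpectrum.le_iff_specializes y v).mpr hyv
  exact PrimeSpectrum.ext (le_antisymm h2 h1)

/-- ★★ **THE FIRST d = 5 ROW (d): THE τ-FLOOR OF P2d5C IS A LEGAL INPUT OF THE F-HALF.** For every blowing up `g : S′ → Spec 𝒪_{X,v}` along `I = τ̃|_{Spec 𝒪_{X,v}}`: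
(1) `I ≠ ⊥`; (2) `Supp I ⊆ (Reg Spec 𝒪_{X,v})ᶜ`; (3) `S′` is regular off the closed fibre; (4) `S′` satisfies the CM clause at every point.
[folklore assembly; cite: GortzWedhorn2020, Prop. 13.91 (2), (13.19)] [cite: StacksProject, Tag 02OS; Tag 01J7] [cite: Temkin2008, §2.1] -/
theorem tauFloor_P2d5C_input_legal (k : Type) [Field k] [CharP k 2] (f : MvPolynomial (Fin 6) k) (hf : f = X 5 ^ 2 + X 0 ^ 4 * X 5 + X 1 ^ 3 + X 2 ^ 3 + X 3 ^ 3 + X 4 ^ 3)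
    (v : Spec (.of (MvPolynomial (Fin 6) k ⧸ Ideal.span {f})))
    (hv : v.asIdeal = Ideal.span (Set.range fun j : Fin 6 => Ideal.Quotient.mk (Ideal.span {f}) (X j)))
    (S' : Scheme.{0}) (g : S' ⟶ Spec ((Spec (.of (MvPolynomial (Fin 6) k ⧸ Ideal.span {f}))).presheaf.stalk v))
    (hg : IsBlowup g ((affineBlowup.idealSheaf
        (Ideal.span {Ideal.Quotient.mk (Ideal.span {f}) (X 0) ^ 2, Ideal.Quotient.mk (Ideal.span {f}) (X 1), Ideal.Quotient.mk (Ideal.span {f}) (X 2), Ideal.Quotient.mk (Ideal.span {f}) (X 3), Ideal.Quotient.mk (Ideal.span {f}) (X 4), Ideal.Quotient.mk (Ideal.span {f}) (X 5)})).comap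
        ((Spec (.of (MvPolynomial (Fin 6) k ⧸ Ideal.span {f}))).fromSpecStalk v))) :
    ((affineBlowup.idealSheaf
        (Ideal.span {Ideal.Quotient.mk (Ideal.span {f}) (X 0) ^ 2, Ideal.Quotient.mk (Ideal.span {f}) (X 1), Ideal.Quotient.mk (Ideal.span {f}) (X 2), Ideal.Quotient.mk (Ideal.span {f}) (X 3), Ideal.Quotient.mk (Ideal.span {f}) (X 4), Ideal.Quotient.mk (Ideal.span {f}) (X 5)})).comap
        ((Spec (.of (MvPolynomial (Fin 6) k ⧸ Ideal.span {f}))).fromSpecStalk v)) ≠ ⊥ ∧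
    (((((affineBlowup.idealSheaf
        (Ideal.span {Ideal.Quotient.mk (Ideal.span {f}) (X 0) ^ 2, Ideal.Quotient.mk (Ideal.span {f}) (X 1), Ideal.Quotient.mk (Ideal.span {f}) (X 2), Ideal.Quotient.mk (Ideal.span {f}) (X 3), Ideal.Quotient.mk (Ideal.span {f}) (X 4), Ideal.Quotient.mk (Ideal.span {f}) (X 5)})).comap
        ((Spec (.of (MvPolynomial (Fin 6) k ⧸ Ideal.span {f}))).fromSpecStalk v))).support : Set (Spec ((Spec (.of (MvPolynomial (Fin 6) k ⧸ Ideal.span {f}))).presheaf.stalk v))) ⊆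
      (Scheme.regularLocus (Spec ((Spec (.of (MvPolynomial (Fin 6) k ⧸ Ideal.span {f}))).presheaf.stalk v)))ᶜ) ∧
    (∀ s : S', g.base s ≠ closedPoint ((Spec (.of (MvPolynomial (Fin 6) k ⧸ Ideal.span {f}))).presheaf.stalk v) → s ∈ Scheme.regularLocus S') ∧
    (∀ s : S', CMCl (S'.presheaf.stalk s)) := by
  classical
  haveI := P2d5CSpecimen.isIntegral_p2d5c k f hf
  haveI := (Ideal.span_singleton_prime (P2d5CSpecimen.prime_f k f hf).ne_zero).mpr (P2d5CSpecimen.prime_f k f hf)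
  haveI : IsDomain (MvPolynomial (Fin 6) k ⧸ Ideal.span {f}) := Ideal.Quotient.isDomain _
  have hτ0 : (Ideal.span {Ideal.Quotient.mk (Ideal.span {f}) (X 0) ^ 2, Ideal.Quotient.mk (Ideal.span {f}) (X 1), Ideal.Quotient.mk (Ideal.span {f}) (X 2), Ideal.Quotient.mk (Ideal.span {f}) (X 3), Ideal.Quotient.mk (Ideal.span {f}) (X 4), Ideal.Quotient.mk (Ideal.span {f}) (X 5)} : Ideal (MvPolynomial (Fin 6) k ⧸ Ideal.span {f})) ≠ ⊥ := by
    intro h0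
    have hmem : Ideal.Quotient.mk (Ideal.span {f}) (X 0) ^ 2 ∈ (Ideal.span {Ideal.Quotient.mk (Ideal.span {f}) (X 0) ^ 2, Ideal.Quotient.mk (Ideal.span {f}) (X 1), Ideal.Quotient.mk (Ideal.span {f}) (X 2), Ideal.Quotient.mk (Ideal.span {f}) (X 3), Ideal.Quotient.mk (Ideal.span {f}) (X 4), Ideal.Quotient.mk (Ideal.span {f}) (X 5)} : Ideal (MvPolynomial (Fin 6) k ⧸ Ideal.span {f})) := Ideal.subset_span (by simp)
    rw [h0, Ideal.mem_bot] at hmem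
    exact pow_ne_zero 2 (P2d5CSpecimen.mk_X_zero_ne_zero k f hf) hmem
  have hsupp := support_tau_specializes k f v hv
  have h34 := LocalBlowupInputFromCharts.offFibre_regular_and_cmCl_over v (affineBlowup.isBlowup _) hsupp (P2d5CSpecimen.regular_of_ne_vertex k f hf v hv)
    (cmCl_stalk_affineBlowup_tau_over k f hf v hv) hg
  exact ⟨comap_fromSpecStalk_ne_bot (affineBlowup.idealSheaf_ne_bot hτ0) v,
    TauFloorInputLegal.support_comap_subset_compl_regularLocus v _ hsupp (P2d5CSpecimen.vertex_not_mem_regularLocus k f hf v hv), h34.1, h34.2⟩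

/-! ## §4 The τ-floor is NOT F(5)-iso -/

/-- ★ **A point of `Bl_τ X` over the vertex with a NON-FULL stalk** (from the chart `D(ȳ)`: `TauFloorP2d5CYChartNotFull.exists_prime_not_fullCl_blowupAlgebra`). Any field `k`.
[OURS · assembly of landed chart facts] -/
theorem exists_point_over_vertex_not_fullCl (k : Type) [Field k] (f : MvPolynomial (Fin 6) k) (hf : f = X 5 ^ 2 + X 0 ^ 4 * X 5 + X 1 ^ 3 + X 2 ^ 3 + X 3 ^ 3 + X 4 ^ 3)
    (v : Spec (.of (MvPolynomial (Fin 6) k ⧸ Ideal.span {f})))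
    (hv : v.asIdeal = Ideal.span (Set.range fun j : Fin 6 => Ideal.Quotient.mk (Ideal.span {f}) (X j))) :
    ∃ b : ↥(affineBlowup (Ideal.span {Ideal.Quotient.mk (Ideal.span {f}) (X 0) ^ 2, Ideal.Quotient.mk (Ideal.span {f}) (X 1), Ideal.Quotient.mk (Ideal.span {f}) (X 2), Ideal.Quotient.mk (Ideal.span {f}) (X 3), Ideal.Quotient.mk (Ideal.span {f}) (X 4), Ideal.Quotient.mk (Ideal.span {f}) (X 5)} : Ideal (MvPolynomial (Fin 6) k ⧸ Ideal.span {f}))),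
      (affineBlowup.π _).base b = v ∧ ¬ FullCl 2 ((affineBlowup (Ideal.span {Ideal.Quotient.mk (Ideal.span {f}) (X 0) ^ 2, Ideal.Quotient.mk (Ideal.span {f}) (X 1), Ideal.Quotient.mk (Ideal.span {f}) (X 2), Ideal.Quotient.mk (Ideal.span {f}) (X 3), Ideal.Quotient.mk (Ideal.span {f}) (X 4), Ideal.Quotient.mk (Ideal.span {f}) (X 5)} : Ideal (MvPolynomial (Fin 6) k ⧸ Ideal.span {f}))).presheaf.stalk b) := by
  classical
  obtain ⟨Q, hQ, hyQ, hbad⟩ := TauFloorP2d5CYChartNotFull.exists_prime_not_fullCl_blowupAlgebra k f hf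
  have hy : Ideal.Quotient.mk (Ideal.span {f}) (X 1) ∈ (Ideal.span {Ideal.Quotient.mk (Ideal.span {f}) (X 0) ^ 2, Ideal.Quotient.mk (Ideal.span {f}) (X 1), Ideal.Quotient.mk (Ideal.span {f}) (X 2), Ideal.Quotient.mk (Ideal.span {f}) (X 3), Ideal.Quotient.mk (Ideal.span {f}) (X 4), Ideal.Quotient.mk (Ideal.span {f}) (X 5)} : Ideal (MvPolynomial (Fin 6) k ⧸ Ideal.span {f})) := Ideal.subset_span (by simp)
  obtain ⟨b, hb, hbadb⟩ := TauFloorInputNotFull.exists_point_over_centre_not_fullCl _ _ hy 2 Q hyQ hbad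
  refine ⟨b, ?_, hbadb⟩
  haveI hmax : v.asIdeal.IsMaximal := P2d5CSpecimen.isMaximal_vertex k f hf v hv
  have h1 : v.asIdeal ≤ ((affineBlowup.π _).base b).asIdeal := by
    rw [hv, Ideal.span_le]
    rintro _ ⟨j, rfl⟩
    fin_cases j
    · exact ((affineBlowup.π _).base b).2.mem_of_pow_mem 2 (hb (Ideal.subset_span (by simp)))
    · exact hb (Ideal.subset_span (by simp))
    · exact hb (Ideal.subset_span (by simp))
    · exact hb (Ideal.subset_span (by simp))
    · exact hb (Ideal.subset_span (by simp))
    · exact hb (Ideal.subset_span (by simp))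
  exact (PrimeSpectrum.ext (hmax.eq_of_le ((affineBlowup.π _).base b).2.ne_top h1)).symm

/-- ★★ **THE FIRST d = 5 ROW (e): THE τ-FLOOR OF P2d5C IS NOT AN F(5)-iso INPUT.** For every blowing up `g : S′ → Spec 𝒪_{X,v}` along `I` there is a point `s ∈ S′`
over the closed point whose local ring is NOT FULL. Any field `k`. [OURS · assembly; cite: GortzWedhorn2020, Prop. 13.91 (2)] [cite: Temkin2008, §2.1] -/
theorem tauFloor_P2d5C_not_full (k : Type) [Field k] (f : MvPolynomial (Fin 6) k) (hf : f = X 5 ^ 2 + X 0 ^ 4 * X 5 + X 1 ^ 3 + X 2 ^ 3 + X 3 ^ 3 + X 4 ^ 3)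
    (v : Spec (.of (MvPolynomial (Fin 6) k ⧸ Ideal.span {f})))
    (hv : v.asIdeal = Ideal.span (Set.range fun j : Fin 6 => Ideal.Quotient.mk (Ideal.span {f}) (X j)))
    (S' : Scheme.{0}) (g : S' ⟶ Spec ((Spec (.of (MvPolynomial (Fin 6) k ⧸ Ideal.span {f}))).presheaf.stalk v))
    (hg : IsBlowup g ((affineBlowup.idealSheaf
        (Ideal.span {Ideal.Quotient.mk (Ideal.span {f}) (X 0) ^ 2, Ideal.Quotient.mk (Ideal.span {f}) (X 1), Ideal.Quotient.mk (Ideal.span {f}) (X 2), Ideal.Quotient.mk (Ideal.span {f}) (X 3), Ideal.Quotient.mk (Ideal.span {f}) (X 4), Ideal.Quotient.mk (Ideal.span {f}) (X 5)})).comap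
        ((Spec (.of (MvPolynomial (Fin 6) k ⧸ Ideal.span {f}))).fromSpecStalk v))) :
    ∃ s : S', g.base s = closedPoint ((Spec (.of (MvPolynomial (Fin 6) k ⧸ Ideal.span {f}))).presheaf.stalk v) ∧ ¬ FullCl 2 (S'.presheaf.stalk s) :=
  TauFloorInputNotFull.exists_not_fullCl_of_isBlowup_comap_fromSpecStalk 2 v (affineBlowup.isBlowup _) (exists_point_over_vertex_not_fullCl k f hf v hv) hg

/-! ## §5 The input side of the first d = 5 row as one theorem -/

/-- ★★★ **THE FIRST d = 5 KERNEL ROW, INPUT SIDE (P2d5C τ-floor; char 2) AS ONE KERNEL THEOREM: LEGAL ∧ NOT F(5)-iso.** For every blowing up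
`g : S′ → Spec 𝒪_{X,v}` along `I = τ̃|_{Spec 𝒪_{X,v}}`: (legal, §3) `I ≠ ⊥`, `Supp I ⊆ (Reg)ᶜ`, `S′` regular off the closed fibre and CM everywhere; (NOT F(5)-iso, §4)
some stalk of `S′` over the closed point is NOT FULL. (The cure conjunct `tauFloor_P2d5C_row` is res-L1-w45a-stub-2's half.) [OURS · assembly of landed theorems] -/
theorem tauFloor_P2d5C_input (k : Type) [Field k] [CharP k 2] (f : MvPolynomial (Fin 6) k) (hf : f = X 5 ^ 2 + X 0 ^ 4 * X 5 + X 1 ^ 3 + X 2 ^ 3 + X 3 ^ 3 + X 4 ^ 3)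
    (v : Spec (.of (MvPolynomial (Fin 6) k ⧸ Ideal.span {f})))
    (hv : v.asIdeal = Ideal.span (Set.range fun j : Fin 6 => Ideal.Quotient.mk (Ideal.span {f}) (X j)))
    (S' : Scheme.{0}) (g : S' ⟶ Spec ((Spec (.of (MvPolynomial (Fin 6) k ⧸ Ideal.span {f}))).presheaf.stalk v))
    (hg : IsBlowup g ((affineBlowup.idealSheaf
        (Ideal.span {Ideal.Quotient.mk (Ideal.span {f}) (X 0) ^ 2, Ideal.Quotient.mk (Ideal.span {f}) (X 1), Ideal.Quotient.mk (Ideal.span {f}) (X 2), Ideal.Quotient.mk (Ideal.span {f}) (X 3), Ideal.Quotient.mk (Ideal.span {f}) (X 4), Ideal.Quotient.mk (Ideal.span {f}) (X 5)})).comap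
        ((Spec (.of (MvPolynomial (Fin 6) k ⧸ Ideal.span {f}))).fromSpecStalk v))) :
    (((affineBlowup.idealSheaf
        (Ideal.span {Ideal.Quotient.mk (Ideal.span {f}) (X 0) ^ 2, Ideal.Quotient.mk (Ideal.span {f}) (X 1), Ideal.Quotient.mk (Ideal.span {f}) (X 2), Ideal.Quotient.mk (Ideal.span {f}) (X 3), Ideal.Quotient.mk (Ideal.span {f}) (X 4), Ideal.Quotient.mk (Ideal.span {f}) (X 5)})).comap
        ((Spec (.of (MvPolynomial (Fin 6) k ⧸ Ideal.span {f}))).fromSpecStalk v)) ≠ ⊥ ∧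
    (((((affineBlowup.idealSheaf
        (Ideal.span {Ideal.Quotient.mk (Ideal.span {f}) (X 0) ^ 2, Ideal.Quotient.mk (Ideal.span {f}) (X 1), Ideal.Quotient.mk (Ideal.span {f}) (X 2), Ideal.Quotient.mk (Ideal.span {f}) (X 3), Ideal.Quotient.mk (Ideal.span {f}) (X 4), Ideal.Quotient.mk (Ideal.span {f}) (X 5)})).comap
        ((Spec (.of (MvPolynomial (Fin 6) k ⧸ Ideal.span {f}))).fromSpecStalk v))).support : Set (Spec ((Spec (.of (MvPolynomial (Fin 6) k ⧸ Ideal.span {f}))).presheaf.stalk v))) ⊆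
      (Scheme.regularLocus (Spec ((Spec (.of (MvPolynomial (Fin 6) k ⧸ Ideal.span {f}))).presheaf.stalk v)))ᶜ) ∧
    (∀ s : S', g.base s ≠ closedPoint ((Spec (.of (MvPolynomial (Fin 6) k ⧸ Ideal.span {f}))).presheaf.stalk v) → s ∈ Scheme.regularLocus S') ∧
    (∀ s : S', CMCl (S'.presheaf.stalk s))) ∧
    (∃ s : S', g.base s = closedPoint ((Spec (.of (MvPolynomial (Fin 6) k ⧸ Ideal.span {f}))).presheaf.stalk v) ∧ ¬ FullCl 2 (S'.presheaf.stalk s)) :=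
  ⟨tauFloor_P2d5C_input_legal k f hf v hv S' g hg, tauFloor_P2d5C_not_full k f hf v hv S' g hg⟩

/-! ## §6 Row #1 of the F(5)-pos ledger as one theorem -/

/-- ★★★ **ROW #1 OF THE F(5)-pos LEDGER (P2d5C τ-floor; char 2) AS ONE KERNEL THEOREM: LEGAL ∧ NOT F(5)-iso ∧ CURED.** For every blowing up
`g : S′ → Spec 𝒪_{X,v}` along `I = τ̃|_{Spec 𝒪_{X,v}}`: (legal, §3) `I ≠ ⊥`, `Supp I ⊆ (Reg)ᶜ`, `S′` regular off the closed fibre and CM everywhere; (NOT F(5)-iso, §4)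
some stalk of `S′` over the closed point is NOT FULL; (cured, res-L1-w45a-stub-2's `TauFloorP2d5CRow.tauFloor_P2d5C_row` over his `τ·K` product certificate) there is
`𝓚 ≠ ⊥` on `S′`, supported over the closed point, ALL of whose blowings up are FULL at every stalk. [OURS · assembly of landed theorems] -/
theorem f5pos_row_one (k : Type) [Field k] [CharP k 2] (f : MvPolynomial (Fin 6) k) (hf : f = X 5 ^ 2 + X 0 ^ 4 * X 5 + X 1 ^ 3 + X 2 ^ 3 + X 3 ^ 3 + X 4 ^ 3)
    (v : Spec (.of (MvPolynomial (Fin 6) k ⧸ Ideal.span {f})))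
    (hv : v.asIdeal = Ideal.span (Set.range fun j : Fin 6 => Ideal.Quotient.mk (Ideal.span {f}) (X j)))
    (S' : Scheme.{0}) (g : S' ⟶ Spec ((Spec (.of (MvPolynomial (Fin 6) k ⧸ Ideal.span {f}))).presheaf.stalk v))
    (hg : IsBlowup g ((affineBlowup.idealSheaf
        (Ideal.span {Ideal.Quotient.mk (Ideal.span {f}) (X 0) ^ 2, Ideal.Quotient.mk (Ideal.span {f}) (X 1), Ideal.Quotient.mk (Ideal.span {f}) (X 2), Ideal.Quotient.mk (Ideal.span {f}) (X 3), Ideal.Quotient.mk (Ideal.span {f}) (X 4), Ideal.Quotient.mk (Ideal.span {f}) (X 5)})).comap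
        ((Spec (.of (MvPolynomial (Fin 6) k ⧸ Ideal.span {f}))).fromSpecStalk v))) :
    (((affineBlowup.idealSheaf
        (Ideal.span {Ideal.Quotient.mk (Ideal.span {f}) (X 0) ^ 2, Ideal.Quotient.mk (Ideal.span {f}) (X 1), Ideal.Quotient.mk (Ideal.span {f}) (X 2), Ideal.Quotient.mk (Ideal.span {f}) (X 3), Ideal.Quotient.mk (Ideal.span {f}) (X 4), Ideal.Quotient.mk (Ideal.span {f}) (X 5)})).comap
        ((Spec (.of (MvPolynomial (Fin 6) k ⧸ Ideal.span {f}))).fromSpecStalk v)) ≠ ⊥ ∧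
    (((((affineBlowup.idealSheaf
        (Ideal.span {Ideal.Quotient.mk (Ideal.span {f}) (X 0) ^ 2, Ideal.Quotient.mk (Ideal.span {f}) (X 1), Ideal.Quotient.mk (Ideal.span {f}) (X 2), Ideal.Quotient.mk (Ideal.span {f}) (X 3), Ideal.Quotient.mk (Ideal.span {f}) (X 4), Ideal.Quotient.mk (Ideal.span {f}) (X 5)})).comap
        ((Spec (.of (MvPolynomial (Fin 6) k ⧸ Ideal.span {f}))).fromSpecStalk v))).support : Set (Spec ((Spec (.of (MvPolynomial (Fin 6) k ⧸ Ideal.span {f}))).presheaf.stalk v))) ⊆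
      (Scheme.regularLocus (Spec ((Spec (.of (MvPolynomial (Fin 6) k ⧸ Ideal.span {f}))).presheaf.stalk v)))ᶜ) ∧
    (∀ s : S', g.base s ≠ closedPoint ((Spec (.of (MvPolynomial (Fin 6) k ⧸ Ideal.span {f}))).presheaf.stalk v) → s ∈ Scheme.regularLocus S') ∧
    (∀ s : S', CMCl (S'.presheaf.stalk s))) ∧
    (∃ s : S', g.base s = closedPoint ((Spec (.of (MvPolynomial (Fin 6) k ⧸ Ideal.span {f}))).presheaf.stalk v) ∧ ¬ FullCl 2 (S'.presheaf.stalk s)) ∧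
    (∃ 𝓚 : S'.IdealSheafData, 𝓚 ≠ ⊥ ∧
      (∀ s ∈ (𝓚.support : Set S'), g.base s = closedPoint ((Spec (.of (MvPolynomial (Fin 6) k ⧸ Ideal.span {f}))).presheaf.stalk v)) ∧
      ∀ (S'' : Scheme.{0}) (π : S'' ⟶ S'), IsBlowup π 𝓚 → ∀ s : S'', FullCl 2 (S''.presheaf.stalk s)) :=
  ⟨tauFloor_P2d5C_input_legal k f hf v hv S' g hg, tauFloor_P2d5C_not_full k f hf v hv S' g hg,
    TauFloorP2d5CRow.tauFloor_P2d5C_row k f hf v hv S' g hg⟩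

end Summit.ResolutionOfSingularities.ResolutionOfSingularities.Theorems.FInjectiveMacaulayfication.TauFloorP2d5CInput

end
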